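import Mathlib
import Summits.Ventures.PercRepro2.OneEdge
import Summits.Ventures.PercRepro2.KPrimeReduction
import Summits.Ventures.PercRepro2.KPrimeVYDict
import Summits.Ventures.PercRepro2.KPrimeLeakPendant
import Summits.Ventures.PercRepro2.KPrimeLeakLinear
import Summits.Ventures.PercRepro2.KPrimeLeakGlueO1
import Summits.Ventures.PercRepro2.KPrimeLeakGlueHDBase

/-!
# The `(H − D)`-piece of the glue is a theorem: the `U ∩ Ω ∩ {a₂ ↮ y}`-share of `N` does not
fall when `a₁`'s root grows by `z`
(blind cell PercRepro2, mine-c g37; `conjectures/MINE-C.md` §46.10 (e), §46.11)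

`P⁰(U ∩ Ω ∩ Yᶜ) · P¹¹(N) ≤ P¹¹(U ∩ Ω ∩ Yᶜ) · P⁰(N)` (`P⁰ = p[e₂ ↦ 0]`, `P¹¹ = p[e₂ ↦ 1][e₁ ↦ 1]`,
`Y = {a₂ ↔ y}`; `glue_piece_hd`) — the third theorem-level cross-world slack of the glue algebra
(`hd_d0` of `uglue_lpdata.py`), the mirror of §46.9's `glue_piece_o1` with the fibration over
`C(a₂)` in place of `C(a₁)`: the one-world inequality `hd_avoid_pa` of
`KPrimeLeakGlueHDBase.lean`, then the leak dictionary at the bridge — `P¹¹(N) =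
P¹⁰(N ∩ {z ↮ {a₂, v}}) ≤ P¹⁰(N ∩ {a₂ ↮ z})` (`prob_glued_N_eq`) and `P¹⁰(U∩Ω∩Yᶜ ∩ {a₂ ↮ z}) ≤
P¹¹(U∩Ω∩Yᶜ)` (`prob_glued_UOYc_ge`: on `{a₂ ↮ z}` opening the bridge keeps `a₁ ↔ v`, `a₁ ↮ a₂`
and `a₂ ↮ y`), the base masses of `p¹⁰` being those of `p⁰`.
-/

namespace Summit.Ventures.PercRepro2

namespace KPrime

variable {V : Type*} {E : Type*} [Fintype E] [DecidableEq E] [Fintype V] [DecidableEq V]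
  {R : Type*} [Field R] [LinearOrder R] [IsStrictOrderedRing R]

section Leak

variable {ends : E → Sym2 V} {a₁ a₂ b v y z : V} {e₁ e₂ : E} {p : E → R}

omit [Fintype V] [DecidableEq V] in
/-- **The leak dictionary for `U ∩ Ω ∩ Yᶜ`**: `P¹⁰(U∩Ω∩Yᶜ ∩ {a₂ ↮ z}) ≤ P¹¹(U∩Ω∩Yᶜ)` — on
`{a₂ ↮ z}` opening the bridge keeps `a₁ ↔ v`, `a₁ ↮ a₂` and `a₂ ↮ y`. -/
lemma prob_glued_UOYc_ge (hp : IsProbVec p) (hb : ∀ f, b ∈ ends f → f = e₁ ∨ f = e₂)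
    (h₁ : ends e₁ = s(b, a₁)) (h₂ : ends e₂ = s(b, z)) (hne : e₁ ≠ e₂)
    (hba₂ : b ≠ a₂) :
    prob (Function.update (Function.update p e₂ 1) e₁ 0)
        (connEvent ends a₁ v ∩ Ω ends a₁ a₂ ∩ (connEvent ends a₂ y)ᶜ ∩ (connEvent ends a₂ z)ᶜ) ≤
      prob (Function.update (Function.update p e₂ 1) e₁ 1)
        (connEvent ends a₁ v ∩ Ω ends a₁ a₂ ∩ (connEvent ends a₂ y)ᶜ) := by
  have hb' : ∀ f, b ∈ ends f → f = e₂ ∨ f = e₁ := fun f h => (hb f h).symm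
  have hp'' : IsProbVec (Function.update (Function.update p e₂ 1) e₁ 0) :=
    (hp.update e₂ zero_le_one le_rfl).update e₁ le_rfl zero_le_one
  have he : Function.update (Function.update p e₂ 1) e₁ 0 e₁ ≠ 1 := by simp
  set A : Set (Config E) := connEvent ends a₁ v ∩ Ω ends a₁ a₂ ∩ (connEvent ends a₂ y)ᶜ with hA
  set B' : Set (Config E) := {ω | Function.update ω e₁ true ∈ A} with hB'
  have hdict : prob (Function.update (Function.update p e₂ 1) e₁ 1) A =
      prob (Function.update (Function.update p e₂ 1) e₁ 0) B' := by
    have h11 : Function.update (Function.update p e₂ 1) e₁ 1 =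
        Function.update (Function.update (Function.update p e₂ 1) e₁ 0) e₁ 1 := by
      rw [Function.update_idem]
    have h10 : Function.update (Function.update p e₂ 1) e₁ 0 =
        Function.update (Function.update (Function.update p e₂ 1) e₁ 0) e₁ 0 := by
      rw [Function.update_idem]
    rw [h11]
    conv_rhs => rw [h10]
    apply prob_update_one_eq_update_zero_of_iff he
    intro ω _
    simp only [hB', Set.mem_setOf_eq, Function.update_idem]
  rw [hdict]
  have hcomm : Function.update (Function.update p e₂ 1) e₁ 0 =
      Function.update (Function.update p e₁ 0) e₂ 1 := Function.update_comm hne.symm _ _ _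
  have hsupp : ∀ C : Set (Config E),
      prob (Function.update (Function.update p e₂ 1) e₁ 0) C =
        prob (Function.update (Function.update p e₂ 1) e₁ 0) (C ∩ closedEdge e₁ ∩ openEdge e₂) := by
    intro C
    rw [← prob_update_zero_inter_closedEdge (Function.update p e₂ 1) C e₁]
    conv_lhs => rw [hcomm]
    rw [← prob_update_one_inter_openEdge (Function.update p e₁ 0) (C ∩ closedEdge e₁) e₂, ← hcomm]
  rw [hsupp (A ∩ (connEvent ends a₂ z)ᶜ)]
  refine prob_mono hp'' ?_
  rintro ω ⟨⟨⟨hc, hZ⟩, hf⟩, hg⟩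
  rw [mem_closedEdge] at hf
  rw [mem_openEdge] at hg
  have hle : ω ≤ Function.update ω e₁ true := by
    intro e
    by_cases he' : e = e₁
    · subst he'; simp [hf]
    · simp [Function.update_of_ne he']
  have hbz : ∀ {s : V}, s ≠ b → (Conn ends ω s b ↔ Conn ends ω s z) := fun hs =>
    conn_b_iff_conn_x₁ (f := e₂) (g := e₁) (x₁ := z) hb' h₂ hne.symm hf hg hs
  simp only [hB', Set.mem_setOf_eq]
  simp only [hA, Ω, Set.mem_inter_iff, Set.mem_compl_iff, mem_connEvent, avoidAll,
    Set.mem_setOf_eq, Finset.mem_singleton, forall_eq] at hc hZ ⊢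
  obtain ⟨⟨hv, ha₂⟩, hy⟩ := hc
  refine ⟨⟨conn_mono hle hv, ?_⟩, ?_⟩
  · rw [OneEdge.conn_update_true_iff h₁]
    rintro (h | ⟨_, h⟩ | ⟨_, h⟩)
    · exact ha₂ h
    · exact ha₂ h
    · exact hZ ((hbz (Ne.symm hba₂)).1 (conn_symm h))
  · rw [OneEdge.conn_update_true_iff h₁]
    rintro (h | ⟨h, _⟩ | ⟨h, _⟩)
    · exact hy h
    · exact hZ ((hbz (Ne.symm hba₂)).1 h)
    · exact ha₂ (conn_symm h)

/-- **The `(H − D)`-piece of the glue is a theorem**: with `b` attached to `a₁` by `e₁` and to `z`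
by `e₂` (and to nothing else),
`P⁰(U∩Ω∩Yᶜ) · P¹¹(N) ≤ P¹¹(U∩Ω∩Yᶜ) · P⁰(N)` (`P⁰ = p[e₂ ↦ 0]`, `P¹¹ = p[e₂ ↦ 1][e₁ ↦ 1]`):
the `{a₁ ↔ v, a₁ ↮ a₂, a₂ ↮ y}`-share of `N` does not fall when `a₁`'s root grows by `z`. -/
theorem glue_piece_hd (hp : IsProbVec p) (hb : ∀ f, b ∈ ends f → f = e₁ ∨ f = e₂)
    (h₁ : ends e₁ = s(b, a₁)) (h₂ : ends e₂ = s(b, z)) (hne : e₁ ≠ e₂)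
    (hba₁ : b ≠ a₁) (hba₂ : b ≠ a₂) (hbv : b ≠ v) (hby : b ≠ y) :
    prob (Function.update p e₂ 0)
        (connEvent ends a₁ v ∩ Ω ends a₁ a₂ ∩ (connEvent ends a₂ y)ᶜ) *
        prob (Function.update (Function.update p e₂ 1) e₁ 1) (N ends a₁ a₂ v) ≤
      prob (Function.update (Function.update p e₂ 1) e₁ 1)
          (connEvent ends a₁ v ∩ Ω ends a₁ a₂ ∩ (connEvent ends a₂ y)ᶜ) *
        prob (Function.update p e₂ 0) (N ends a₁ a₂ v) := by
  have hb' : ∀ f, b ∈ ends f → f = e₂ ∨ f = e₁ := fun f h => (hb f h).symm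
  have hp'' : IsProbVec (Function.update (Function.update p e₂ 1) e₁ 0) :=
    (hp.update e₂ zero_le_one le_rfl).update e₁ le_rfl zero_le_one
  have hNX : ∀ x ∈ ({a₂, v} : Finset V), x ≠ b := fun x hx => by
    simp only [Finset.mem_insert, Finset.mem_singleton] at hx
    rcases hx with rfl | rfl
    · exact Ne.symm hba₂
    · exact Ne.symm hbv
  have hΩX : ∀ x ∈ ({a₂} : Finset V), x ≠ b := fun x hx => by
    simp only [Finset.mem_singleton] at hx
    subst hx; exact Ne.symm hba₂
  have hN₁ : PendInv e₁ e₂ (N ends a₁ a₂ v) := pendInv_avoidAll hb h₁ hne (Ne.symm hba₁) hNX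
  have hN₂ : PendInv e₂ e₁ (N ends a₁ a₂ v) := pendInv_avoidAll hb' h₂ hne.symm (Ne.symm hba₁) hNX
  have hA₁ : PendInv e₁ e₂ (connEvent ends a₁ v ∩ Ω ends a₁ a₂ ∩ (connEvent ends a₂ y)ᶜ) :=
    ((pendInv_connEvent hb h₁ hne (Ne.symm hba₁) (Ne.symm hbv)).inter
      (pendInv_avoidAll hb h₁ hne (Ne.symm hba₁) hΩX)).inter
      (pendInv_connEvent hb h₁ hne (Ne.symm hba₂) (Ne.symm hby)).compl
  have hA₂ : PendInv e₂ e₁ (connEvent ends a₁ v ∩ Ω ends a₁ a₂ ∩ (connEvent ends a₂ y)ᶜ) :=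
    ((pendInv_connEvent hb' h₂ hne.symm (Ne.symm hba₁) (Ne.symm hbv)).inter
      (pendInv_avoidAll hb' h₂ hne.symm (Ne.symm hba₁) hΩX)).inter
      (pendInv_connEvent hb' h₂ hne.symm (Ne.symm hba₂) (Ne.symm hby)).compl
  rw [← prob_pendantZ_eq_leakClosed hne hA₁ hA₂, ← prob_pendantZ_eq_leakClosed hne hN₁ hN₂,
    prob_glued_N_eq hb h₁ h₂ hne hba₂ hbv]
  -- `{z ↮ {a₂, v}} ⊆ {a₂ ↮ z}`
  have hsub : N ends a₁ a₂ v ∩ avoidAll ends z {a₂, v} ⊆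
      N ends a₁ a₂ v ∩ (connEvent ends a₂ z)ᶜ := by
    rintro ω ⟨hN, hZ⟩
    refine ⟨hN, fun hc => ?_⟩
    exact hZ a₂ (by simp) (conn_symm hc)
  have hA0 : 0 ≤ prob (Function.update (Function.update p e₂ 1) e₁ 0)
      (connEvent ends a₁ v ∩ Ω ends a₁ a₂ ∩ (connEvent ends a₂ y)ᶜ) := prob_nonneg hp'' _
  calc prob (Function.update (Function.update p e₂ 1) e₁ 0)
        (connEvent ends a₁ v ∩ Ω ends a₁ a₂ ∩ (connEvent ends a₂ y)ᶜ) *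
        prob (Function.update (Function.update p e₂ 1) e₁ 0)
          (N ends a₁ a₂ v ∩ avoidAll ends z {a₂, v})
      ≤ prob (Function.update (Function.update p e₂ 1) e₁ 0)
          (connEvent ends a₁ v ∩ Ω ends a₁ a₂ ∩ (connEvent ends a₂ y)ᶜ) *
        prob (Function.update (Function.update p e₂ 1) e₁ 0)
          (N ends a₁ a₂ v ∩ (connEvent ends a₂ z)ᶜ) :=
        mul_le_mul_of_nonneg_left (prob_mono hp'' hsub) hA0
    _ ≤ prob (Function.update (Function.update p e₂ 1) e₁ 0)
          (connEvent ends a₁ v ∩ Ω ends a₁ a₂ ∩ (connEvent ends a₂ y)ᶜ ∩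
            (connEvent ends a₂ z)ᶜ) *
        prob (Function.update (Function.update p e₂ 1) e₁ 0) (N ends a₁ a₂ v) :=
        hd_avoid_pa hp''
    _ ≤ prob (Function.update (Function.update p e₂ 1) e₁ 1)
          (connEvent ends a₁ v ∩ Ω ends a₁ a₂ ∩ (connEvent ends a₂ y)ᶜ) *
        prob (Function.update (Function.update p e₂ 1) e₁ 0) (N ends a₁ a₂ v) :=
        mul_le_mul_of_nonneg_right (prob_glued_UOYc_ge hp hb h₁ h₂ hne hba₂)
          (prob_nonneg hp'' _)

end Leak

end KPrime

end Summit.Ventures.PercRepro2
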